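import Literature.NumberTheory.EllipticCurves.ModularDegreeSpectralLevelBound
import HarnessLib

/-!
# Pasten 2024, Thm 7.5 (height clauses) from Thm 7.2 at `D = 1` — the §7.4 deduction over the tree
# (proofs)

Topic `Literature/NumberTheory/EllipticCurves`; companion PROOF file (theorems only, no new statement;
D-0026) of `ModularDegreeSpectralLevelBound.lean` (H. Pasten, *Shimura curves and the abc conjecture*,
J. Number Theory 254 (2024) = arXiv:1705.09251, §7.4 [`PastenShimura2024`]). Printed proof of Thm 7.5:
"The classical modular approach to Szpiro's conjecture (cf. Section 3, especially the estimates
(EqDiscH) and (EqHDeg)) together with our bounds for `δ_{D,M}` specialized to `D = 1, M = N`". Here the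
two HEIGHT clauses are reduced to the named facts they rest on:

* `PastenShimura2024_thm_7_5_height_of_thm_7_2` — the asymptotic clause `h(E) < (1/48 + ε) N log N`
  from modularity with an integral Manin constant (`nonempty_modularParametrizationData`), Mazur–Kenku
  (`PastenShimura2024_minimalDegree_le_163_mul`) and Thm 7.2 (asymptotic, `D = 1`,
  `PastenShimura2024_thm_7_2_asymptotic`) — the same trust base as the rung
  `epsShapeBound_one_of_modularity_of_thm_7_2`;
* `PastenShimura2024_thm_7_5_height_explicit_of_thm_7_2` — the explicit clause
  `h(E) ≤ (1/24)(N + 7 d(N²))(log N + 4 log N / log log N) + 9` from the same two facts and Thm 7.2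
  (explicit, `D = 1`, `PastenShimura2024_thm_7_2_explicit`); the constant of the tree's (EqHDeg) is
  `½ log 163 + 2π − ½ log π ≈ 8.26 ≤ 9`.

Tree inputs (all PROVED): Zagier's identity and the trivial Petersson bound packaged as
`Pasten2024.twelve_mul_neronLatticeHeight_le` / `log_four_pi_sq_mul_trivialPeterssonConst`, the global
minimal model (`hasGlobalMinimalModel_rat_holds`, `faltingsHeight_smul`, `conductorNorm_smul_rat`),
`Pasten2024.log_minModularDegree_le_of_class_bound`.

## References

* [PastenShimura2024] H. Pasten, J. Number Theory 254 (2024) = arXiv:1705.09251: §3 (3.1)–(3.2),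
  §7.4 Thm 7.5 (arXiv p. 27).
-/

noncomputable section

open WeierstrassCurve

namespace Literature.NumberTheory.EllipticCurves

open ModularForms Pasten2024 ModularForm CongruenceSubgroup
open scoped MatrixGroups

/-- **(EqHDeg) over the tree, uniform form** (globally minimal model): for a globally minimal
elliptic `W/ℚ` and every bound `B` on `log δ_{1,N}` over the data of minimal degree in the class at
level `N_W`, `h(W) ≤ ½ (log 163 + B) + 2π − ½ log π` (Zagier + trivial Petersson bound + Mazur–Kenku).
[cite: PastenShimura2024, §3 (3.2) and p. 13 (h(E) ≤ ½ log δ_{1,N} + 9)] -/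
theorem faltingsHeight_le_of_class_bound (hmod : nonempty_modularParametrizationData)
    (h163 : PastenShimura2024_minimalDegree_le_163_mul) (W : WeierstrassCurve ℚ) [W.IsElliptic]
    [W.IsGloballyMinimal] [NeZero (W.conductorNorm ℤ)] {B : ℝ}
    (hB : ∀ (W₀ : WeierstrassCurve ℚ) [W₀.IsElliptic]
      (D₀ : ModularParametrizationData W₀ (W.conductorNorm ℤ)),
      (∀ (W'' : WeierstrassCurve ℚ) [W''.IsElliptic]
          (D'' : ModularParametrizationData W'' (W.conductorNorm ℤ)),
          D''.f = D₀.f → D₀.modularDegree ≤ D''.modularDegree) →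
        Real.log (D₀.modularDegree : ℝ) < B) :
    W.faltingsHeight ≤ (1 / 2) * (Real.log 163 + B) + 2 * Real.pi - (1 / 2) * Real.log Real.pi := by
  obtain ⟨D, hDmin⟩ := exists_modularDegree_eq_minModularDegree (hmod W)
  have hDmin' : D.deg = minModularDegree W (W.conductorNorm ℤ) := hDmin
  have hclass := log_minModularDegree_le_of_class_bound h163 (hmod W) (B := B) hB
  have hc₀ : (0 : ℝ) < Real.exp (-(4 * Real.pi)) / (4 * Real.pi) := by positivity
  have hh := twelve_mul_neronLatticeHeight_le D hc₀ D.isNewformOf.peterssonProduct_re_ge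
  rw [log_four_pi_sq_mul_trivialPeterssonConst] at hh
  have hheight : W.faltingsHeight = neronLatticeHeight D.L := by
    rw [D.faltingsHeight_eq, neronLatticeHeight]
  rw [hheight]
  rw [hDmin'] at hh
  linarith

/-- The numerical constant of the tree's (EqHDeg): `½ log 163 + 2π − ½ log π < 8.6 ≤ 9` (Pasten
prints `+ 9`). Generous numerics: `log 163 ≤ 8 log 2`, `π < 3.15`, `log π > 1`.
[cite: PastenShimura2024, §3 p. 13 (h(E) ≤ ½ log δ_{1,N} + 9)] -/
theorem eqHDeg_const_lt : (1 / 2 : ℝ) * Real.log 163 + 2 * Real.pi - (1 / 2) * Real.log Real.pi < 8.6 := by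
  have h163 : Real.log 163 ≤ 8 * Real.log 2 := by
    rw [← Real.log_rpow (by norm_num), show ((2 : ℝ) ^ (8 : ℝ)) = 256 by norm_num]
    exact Real.log_le_log (by norm_num) (by norm_num)
  have hl2 := Real.log_two_lt_d9
  have hpi := Real.pi_lt_d2
  have he := Real.exp_one_lt_d9
  have hlogpi : 1 < Real.log Real.pi := by
    rw [← Real.log_exp 1]
    exact Real.log_lt_log (Real.exp_pos 1) (by linarith [Real.pi_gt_three])
  linarith

/-- **Pasten 2024, Thm 7.5, asymptotic height clause, from Thm 7.2** (PROVED reduction):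
`PastenShimura2024_thm_7_5_height` (`h(E) < (1/48 + ε) N log N`, `N ≫_ε 1`, all `E/ℚ`) follows from
modularity with an integral Manin constant, Mazur–Kenku, and `PastenShimura2024_thm_7_2_asymptotic`
(`D = 1`) — the §7.4 deduction "(EqHDeg) together with our bounds for `δ_{D,M}` specialized to `D = 1`".
[cite: PastenShimura2024, Thm 7.5 (proof, §7.4, arXiv p. 27)] -/
theorem PastenShimura2024_thm_7_5_height_of_thm_7_2 (hmod : nonempty_modularParametrizationData)
    (h163 : PastenShimura2024_minimalDegree_le_163_mul) (h72 : PastenShimura2024_thm_7_2_asymptotic) :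
    PastenShimura2024_thm_7_5_height := by
  intro ε hε
  obtain ⟨N₁, hN₁⟩ := h72 (ε / 2) (half_pos hε)
  obtain ⟨M, hM⟩ := exists_lt_mul_mul_log (half_pos hε) 9
  refine ⟨max N₁ M, fun W _ hNW => ?_⟩
  obtain ⟨C, hC⟩ := hasGlobalMinimalModel_rat_holds W
  haveI := hC
  have hN : (C • W).conductorNorm ℤ = W.conductorNorm ℤ := conductorNorm_smul_rat W C
  haveI : NeZero ((C • W).conductorNorm ℤ) := ⟨(conductorNorm_pos_holds (C • W)).ne'⟩
  rw [← faltingsHeight_smul W C, ← hN]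
  have hN₁' : N₁ ≤ (C • W).conductorNorm ℤ := by rw [hN]; exact le_trans (le_max_left _ _) hNW
  have hM' : M ≤ (C • W).conductorNorm ℤ := by rw [hN]; exact le_trans (le_max_right _ _) hNW
  have hh := faltingsHeight_le_of_class_bound hmod h163 (C • W)
    (B := (1 / 24 + ε / 2) * ((C • W).conductorNorm ℤ : ℝ) * Real.log ((C • W).conductorNorm ℤ))
    (fun W₀ _ D₀ hmin => hN₁ _ W₀ D₀ hmin hN₁')
  have h9 := hM _ hM'
  have hc := eqHDeg_const_lt
  linarith

/-- **Pasten 2024, Thm 7.5, explicit height clause, from Thm 7.2** (PROVED reduction):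
`PastenShimura2024_thm_7_5_height_explicit` (`h(E) ≤ (1/24)(N + 7d(N²))(log N + 4 log N/log log N) + 9`
for every `E/ℚ`) follows from modularity with an integral Manin constant, Mazur–Kenku, Carayol's
"level = conductor" (`IsNewformOf.level_eq_conductorNorm`, needed because the explicit Thm 7.2 is
recorded with the level pinned to the conductor) and `PastenShimura2024_thm_7_2_explicit` (`D = 1`);
the tree's constant is `½ log 163 + 2π − ½ log π < 9`. [cite: PastenShimura2024, Thm 7.5 (proof, §7.4, arXiv p. 27)] -/
theorem PastenShimura2024_thm_7_5_height_explicit_of_thm_7_2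
    (hmod : nonempty_modularParametrizationData) (h163 : PastenShimura2024_minimalDegree_le_163_mul)
    (hlev : ∀ (N : ℕ) [NeZero N], IsNewformOf.level_eq_conductorNorm (N := N))
    (h72 : PastenShimura2024_thm_7_2_explicit) : PastenShimura2024_thm_7_5_height_explicit := by
  intro W _
  obtain ⟨C, hC⟩ := hasGlobalMinimalModel_rat_holds W
  haveI := hC
  have hN : (C • W).conductorNorm ℤ = W.conductorNorm ℤ := conductorNorm_smul_rat W C
  haveI : NeZero ((C • W).conductorNorm ℤ) := ⟨(conductorNorm_pos_holds (C • W)).ne'⟩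
  rw [← faltingsHeight_smul W C, ← hN]
  set N : ℕ := (C • W).conductorNorm ℤ with hNdef
  set T : ℝ := ((1 / 12 : ℝ) * N + 7 / 12 * ((N ^ 2).divisors.card : ℝ)) *
    (Real.log N + 4 * Real.log N / Real.log (Real.log N)) with hT
  have hh := faltingsHeight_le_of_class_bound hmod h163 (C • W) (B := T + 1 / 100)
    (fun W₀ _ D₀ hmin => by
      have hW₀ : W₀.conductorNorm ℤ = N := (hlev N D₀.isNewformOf).symm
      have := h72 N W₀ D₀ hW₀ hmin
      linarith)
  have hc := eqHDeg_const_lt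
  have : (1 / 2 : ℝ) * (T + 1 / 100) = (1 / 24 : ℝ) * ((N : ℝ) + 7 * ((N ^ 2).divisors.card : ℝ)) *
      (Real.log N + 4 * Real.log N / Real.log (Real.log N)) + 1 / 200 := by
    rw [hT]; ring
  linarith

end Literature.NumberTheory.EllipticCurves

end
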